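import Literature.NumberTheory.NumberFields.AmbiguousIdeals
import Literature.NumberTheory.NumberFields.ClassGroupNormKernelOneRamifiedPrime
import HarnessLib

/-!
# Ambiguous ideals with ONE ramified prime, totally ramified: `𝓘_F^G = ι𝓘_B · 𝔓^ℤ`, and `𝔓^a` is extended iff `[F:B] ∣ a`
# (Lang Ch. 13 §4 Lemma 4.1, eq. (2), in the situation of Washington §13.3: `I^G / I_n ≅ ℤ/[K_m:K_n]` generated by the totally ramified prime)

Topic `NumberTheory/NumberFields` (namespace `Literature.NumberTheory.NumberFields.AmbiguousIdeal`, as the tree's `AmbiguousIdeals.lean`).  THEOREM-ONLY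
file (no definition, no named fact, no `sorry`), written by the prover seat `bsd-wall-rtt-p4-w2` g20 (cell `bsd-wall`; `--supports`
stmt-BirchSwinnertonDyer-21438, line `nonsquare-descent` stub S2, g19's hypothesis «`[I^{G,χ} : I_n^χ] = 1`: `I^G/I_n ≅ ℤ/2^{m−n}·𝔓_m`, `𝔓` unique and
totally ramified»; closes nothing; BSD is proved for no curve here).

Setting (as in `ClassGroupNormKernelOneRamifiedPrime.lean`): `F/B` Galois number fields with cyclic group `⟨σ⟩`, a prime `𝔓` of `F` with
`e(𝔓 | B) = [F : B]` which is the only prime of `F` ramified over `B`.  Inside `𝓘_F = (FractionalIdeal (𝓞 F)⁰ F)ˣ` with the Galois action of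
`AmbiguousClassGaloisAction.lean`, `𝓘_F^G = Herbrand.z0 σ ⊤ ⊥`, `ι = Units.map (extendedHom F (𝓞 F))`:

* `smul_heightOneSpectrum_eq_of_ramificationIdx_eq_finrank` — every `τ ∈ Gal(F/B)` fixes the place `v_𝔓` (it is alone above `𝔓 ∩ B`).
* **`exists_z0_eq_range_sup_zpowers_of_ramificationIdx_eq_finrank`** — with `P = 𝔓` as an invertible fractional ideal: `σ • P = P`,
  `P ^ a ∈ ι𝓘_B ↔ [F:B] ∣ a`, and **`𝓘_F^G = ι𝓘_B ⊔ P^ℤ`** (so `𝓘_F^G / ι𝓘_B ≅ ℤ/[F:B]`, generated by `𝔓`; the index is the tree's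
  `relIndex_range_extendedHom_z0_eq_finprod` = `∏ e = [F:B]`, `AmbiguousClassNumberOneRamifiedPrime.finprod_ramificationIdxIn_eq_finrank`).

References: [Lang1990] Ch. 13 §4, Lemma 4.1 and proof, eq. (2) (PDF pp. 203–204); [Washington1997] §13.3 (proof of Lemma 13.15 / Thm. 13.13: the
ideal side of `Ĥ⁰`, only the totally ramified primes contribute).
-/

noncomputable section

open NumberField IsDedekindDomain FractionalIdeal
open scoped nonZeroDivisors Pointwise

namespace Literature.NumberTheory.NumberFields.AmbiguousIdeal

open Literature.NumberTheory.GaloisRepresentations Literature.NumberTheory.GaloisRepresentations.Herbrand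
  Literature.NumberTheory.NumberFields.AmbiguousClass Literature.NumberTheory.NumberFields.ClassGroupNormKernel
  Literature.NumberTheory.Automorphic

variable {B F : Type} [Field B] [NumberField B] [Field F] [NumberField F] [Algebra B F]

/-- **Every `τ ∈ Gal(F/B)` fixes the place of the totally ramified prime `𝔓`** (`e(𝔓|B) = [F:B]` forces `𝔓` to be the only prime above `𝔓 ∩ B`,
tree `ClassGroupNormKernel.eq_of_under_eq_of_ramificationIdx_eq_finrank`; conjugate places lie over the same prime). [cite: Lang1990, Ch. 13 §4, proof of Lemma 4.1 (PDF p. 203)] -/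
theorem smul_heightOneSpectrum_eq_of_ramificationIdx_eq_finrank [IsGalois B F] (𝔓 : Ideal (𝓞 F)) [h𝔓max : 𝔓.IsMaximal]
    (h𝔓 : 𝔓.ramificationIdx (𝓞 B) = Module.finrank B F) (τ : F ≃ₐ[B] F) (v₀ : HeightOneSpectrum (𝓞 F)) (hv₀ : v₀.asIdeal = 𝔓) :
    τ • v₀ = v₀ := by
  apply HeightOneSpectrum.ext
  haveI : (τ • v₀).asIdeal.IsMaximal := (τ • v₀).isMaximal
  rw [hv₀]
  refine eq_of_under_eq_of_ramificationIdx_eq_finrank 𝔓 h𝔓 (τ • v₀).asIdeal ?_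
  have h := HeightOneSpectrum.under_algEquiv_smul B F τ v₀
  have h' := congrArg HeightOneSpectrum.asIdeal h
  rw [HeightOneSpectrum.under_asIdeal, HeightOneSpectrum.under_asIdeal, hv₀] at h'
  exact h'

/-- A prime of `B` lies under some place of `F`. [folklore] -/
private theorem exists_under_eq_onePrime (u : HeightOneSpectrum (𝓞 B)) : ∃ w : HeightOneSpectrum (𝓞 F), w.under (𝓞 B) = u := by
  haveI : u.asIdeal.IsMaximal := u.isMaximal
  obtain ⟨Q, hQmax, hQ⟩ := Ideal.exists_maximal_ideal_liesOver_of_isIntegral (S := 𝓞 F) u.asIdeal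
  refine ⟨⟨Q, hQmax.isPrime, Ring.ne_bot_of_isMaximal_of_not_isField hQmax (RingOfIntegers.not_isField F)⟩, HeightOneSpectrum.ext ?_⟩
  rw [HeightOneSpectrum.under_asIdeal]
  exact hQ.over.symm

/-- **`𝓘_F^G = ι𝓘_B · 𝔓^ℤ` for one totally ramified prime.**  `F/B` Galois with cyclic group `⟨σ⟩`, `𝔓` a prime of `F` with `e(𝔓|B) = [F:B]` which is
the only prime of `F` ramified over `B`.  Then, with `P = 𝔓 ∈ 𝓘_F`: `σ • P = P`; `P ^ a` is an extended ideal iff `[F:B] ∣ a` (`𝔓^{[F:B]} = ι(𝔓 ∩ B)`);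
and the ambiguous ideals are exactly `ι𝓘_B ⊔ P^ℤ` — every `σ`-invariant invertible fractional ideal is `ι(𝔞) · 𝔓^a` (exponents of an ambiguous ideal are
constant over each prime of `B`, tree `count_eq_of_under_eq`, and every prime `≠ 𝔓` is unramified).  Hence `𝓘_F^G / ι𝓘_B ≅ ℤ/[F:B]·𝔓̄`.
[cite: Lang1990, Ch. 13 §4, Lemma 4.1, proof, eq. (2) (PDF pp. 203–204)] [cite: Washington1997, §13.3 (proof of Lemma 13.15)] -/
theorem exists_z0_eq_range_sup_zpowers_of_ramificationIdx_eq_finrank [IsGalois B F] {σ : F ≃ₐ[B] F}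
    (hσ : ∀ τ : F ≃ₐ[B] F, τ ∈ Subgroup.zpowers σ) (𝔓 : Ideal (𝓞 F)) [h𝔓max : 𝔓.IsMaximal]
    (h𝔓 : 𝔓.ramificationIdx (𝓞 B) = Module.finrank B F)
    (huniq : ∀ (Q : Ideal (𝓞 F)) [Q.IsMaximal], Q.ramificationIdx (𝓞 B) ≠ 1 → Q = 𝔓) :
    ∃ P : (FractionalIdeal (𝓞 F)⁰ F)ˣ, (P : FractionalIdeal (𝓞 F)⁰ F) = ((𝔓 : Ideal (𝓞 F)) : FractionalIdeal (𝓞 F)⁰ F) ∧ σ • P = P ∧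
      (∀ a : ℤ, P ^ a ∈ (Units.map (extendedHom F (𝓞 F) :
          FractionalIdeal (𝓞 B)⁰ B →+* FractionalIdeal (𝓞 F)⁰ F).toMonoidHom).range ↔ (Module.finrank B F : ℤ) ∣ a) ∧
      z0 σ (⊤ : Subgroup (FractionalIdeal (𝓞 F)⁰ F)ˣ) ⊥ =
        (Units.map (extendedHom F (𝓞 F) : FractionalIdeal (𝓞 B)⁰ B →+* FractionalIdeal (𝓞 F)⁰ F).toMonoidHom).range ⊔
          Subgroup.zpowers P := by
  classical
  set ι := (Units.map (extendedHom F (𝓞 F) :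
        FractionalIdeal (𝓞 B)⁰ B →+* FractionalIdeal (𝓞 F)⁰ F).toMonoidHom) with hι
  set n := Module.finrank B F with hn
  have h𝔓0 : 𝔓 ≠ ⊥ := Ring.ne_bot_of_isMaximal_of_not_isField ‹_› (RingOfIntegers.not_isField F)
  set v₀ : HeightOneSpectrum (𝓞 F) := ⟨𝔓, h𝔓max.isPrime, h𝔓0⟩ with hv₀def
  have hv₀ : v₀.asIdeal = 𝔓 := rfl
  set 𝔭 : HeightOneSpectrum (𝓞 B) := v₀.under (𝓞 B) with h𝔭
  -- uniqueness of the prime above `𝔭`, unramifiedness elsewhere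
  have huniq' : ∀ w : HeightOneSpectrum (𝓞 F), w.under (𝓞 B) = 𝔭 → w = v₀ := by
    intro w hw
    apply HeightOneSpectrum.ext
    haveI : w.asIdeal.IsMaximal := w.isMaximal
    rw [hv₀]
    refine eq_of_under_eq_of_ramificationIdx_eq_finrank 𝔓 h𝔓 w.asIdeal ?_
    have h' := congrArg HeightOneSpectrum.asIdeal hw
    rw [HeightOneSpectrum.under_asIdeal, h𝔭, HeightOneSpectrum.under_asIdeal, hv₀] at h'
    exact h'
  have he : ∀ w : HeightOneSpectrum (𝓞 F), w ≠ v₀ → w.asIdeal.ramificationIdx (𝓞 B) = 1 := by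
    intro w hw
    haveI : w.asIdeal.IsMaximal := w.isMaximal
    by_contra h
    exact hw (HeightOneSpectrum.ext (huniq w.asIdeal h))
  have he₀ : v₀.asIdeal.ramificationIdx (𝓞 B) = n := h𝔓
  have hfixv : ∀ τ : F ≃ₐ[B] F, τ • v₀ = v₀ := fun τ => smul_heightOneSpectrum_eq_of_ramificationIdx_eq_finrank 𝔓 h𝔓 τ v₀ hv₀
  -- the ideal `P = 𝔓`
  set P : (FractionalIdeal (𝓞 F)⁰ F)ˣ := Units.mk0 (((𝔓 : Ideal (𝓞 F)) : FractionalIdeal (𝓞 F)⁰ F)) (coeIdeal_ne_zero.mpr h𝔓0) with hP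
  have hPcount : ∀ w : HeightOneSpectrum (𝓞 F), count F w (P : FractionalIdeal (𝓞 F)⁰ F) = if w = v₀ then 1 else 0 := by
    intro w
    rw [hP, Units.val_mk0, ← hv₀, count_maximal F w v₀]
    simp only [eq_comm]
  have hPa : ∀ (a : ℤ) (w : HeightOneSpectrum (𝓞 F)), count F w ((P ^ a : (FractionalIdeal (𝓞 F)⁰ F)ˣ) : FractionalIdeal (𝓞 F)⁰ F) =
      if w = v₀ then a else 0 := by
    intro a w
    rw [count_units_zpow F w P a, hPcount]
    split_ifs <;> simp
  have hιcount : ∀ (J : (FractionalIdeal (𝓞 B)⁰ B)ˣ) (w : HeightOneSpectrum (𝓞 F)),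
      count F w ((ι J : (FractionalIdeal (𝓞 F)⁰ F)ˣ) : FractionalIdeal (𝓞 F)⁰ F) =
        w.asIdeal.ramificationIdx (𝓞 B) * count B (w.under (𝓞 B)) (J : FractionalIdeal (𝓞 B)⁰ B) := by
    intro J w
    rw [hι, Units.coe_map, RingHom.toMonoidHom_eq_coe, MonoidHom.coe_coe, count_extendedHom B F w J]
  -- `σ • P = P`
  have hσP : σ • P = P := by
    refine units_ext_count F fun w => ?_
    rw [count_smul', hPcount, hPcount, inv_smul_eq_iff, hfixv σ]
  -- `P ^ a ∈ ι𝓘_B ↔ n ∣ a`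
  have hpow : ∀ a : ℤ, P ^ a ∈ ι.range ↔ (n : ℤ) ∣ a := by
    intro a
    constructor
    · rintro ⟨J, hJ⟩
      have h1 := hιcount J v₀
      rw [hJ, hPa, if_pos rfl, he₀] at h1
      exact ⟨_, h1⟩
    · rintro ⟨c, rfl⟩
      set Q : (FractionalIdeal (𝓞 B)⁰ B)ˣ := Units.mk0 ((𝔭.asIdeal : FractionalIdeal (𝓞 B)⁰ B)) (coeIdeal_ne_zero.mpr 𝔭.ne_bot) with hQ
      refine ⟨Q ^ c, units_ext_count F fun w => ?_⟩
      rw [hιcount, hPa, Units.val_zpow_eq_zpow_val, count_zpow, hQ, Units.val_mk0, count_maximal B (w.under (𝓞 B)) 𝔭]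
      by_cases hw : w = v₀
      · subst hw
        rw [if_pos h𝔭, if_pos (rfl : v₀ = v₀), he₀, mul_one]
      · have hne : 𝔭 ≠ w.under (𝓞 B) := fun h => hw (huniq' w h.symm)
        rw [if_neg hw, if_neg hne, mul_zero, mul_zero]
  refine ⟨P, by rw [hP, Units.val_mk0], hσP, hpow, le_antisymm ?_ ?_⟩
  · -- `𝓘^G ≤ ι𝓘_B ⊔ P^ℤ`: strip the `𝔓`-part, the rest is extended
    intro I hI
    set a : ℤ := count F v₀ (I : FractionalIdeal (𝓞 F)⁰ F) with ha
    set I' : (FractionalIdeal (𝓞 F)⁰ F)ˣ := I * (P ^ a)⁻¹ with hI'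
    have hI'count : ∀ w, count F w (I' : FractionalIdeal (𝓞 F)⁰ F) =
        count F w (I : FractionalIdeal (𝓞 F)⁰ F) - if w = v₀ then a else 0 := by
      intro w
      rw [hI', count_units_mul F w, count_units_inv F w, hPa, sub_eq_add_neg]
    -- a prime above each prime of `B`
    choose s hs using exists_under_eq_onePrime (B := B) (F := F)
    have hsinj : Function.Injective s := fun u u' h => by rw [← hs u, ← hs u', h]
    -- exponents of the ambiguous `I` are constant over each prime of `B`
    have hconst : ∀ w : HeightOneSpectrum (𝓞 F), count F w (I : FractionalIdeal (𝓞 F)⁰ F) =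
        count F (s (w.under (𝓞 B))) (I : FractionalIdeal (𝓞 F)⁰ F) :=
      fun w => count_eq_of_under_eq hσ hI (hs (w.under (𝓞 B))).symm
    set c : HeightOneSpectrum (𝓞 B) → ℤ := fun u => if u = 𝔭 then 0 else count F (s u) (I : FractionalIdeal (𝓞 F)⁰ F) with hc
    have hcfin : ∀ᶠ u in Filter.cofinite, c u = 0 := by
      rw [Filter.eventually_cofinite]
      refine ((finite_setOf_count_ne_zero F I).preimage hsinj.injOn).subset fun u hu => ?_
      intro h0
      apply hu
      show (if u = 𝔭 then 0 else count F (s u) (I : FractionalIdeal (𝓞 F)⁰ F)) = 0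
      rw [h0, ite_self]
    obtain ⟨J, hJ⟩ := exists_units_count_eq B c hcfin
    have hιJ : ι J = I' := by
      refine units_ext_count F fun w => ?_
      rw [hιcount, hJ, hI'count]
      by_cases hw : w = v₀
      · subst hw
        rw [if_pos rfl, ← ha]
        show v₀.asIdeal.ramificationIdx (𝓞 B) * (if v₀.under (𝓞 B) = 𝔭 then 0 else _) = a - a
        rw [if_pos h𝔭.symm, mul_zero, sub_self]
      · have hne : w.under (𝓞 B) ≠ 𝔭 := fun h => hw (huniq' w h)
        rw [if_neg hw, he w hw, Nat.cast_one, one_mul, sub_zero]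
        show (if w.under (𝓞 B) = 𝔭 then 0 else count F (s (w.under (𝓞 B))) (I : FractionalIdeal (𝓞 F)⁰ F)) = _
        rw [if_neg hne, ← hconst w]
    have hI'mem : I' ∈ ι.range := ⟨J, hιJ⟩
    have hII : I = I' * P ^ a := by rw [hI', inv_mul_cancel_right]
    rw [hII]
    exact Subgroup.mul_mem_sup hI'mem (Subgroup.zpow_mem_zpowers P a)
  · exact sup_le (range_unitsMap_extendedHom_le_z0 σ) (Subgroup.zpowers_le.mpr (mem_z0_bot.mpr ⟨Subgroup.mem_top _, hσP⟩))

end Literature.NumberTheory.NumberFields.AmbiguousIdeal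

end
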